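import Summits.NavierStokesRegularity.NavierStokesRegularity.Theses.TypeICertificateLadder
import Summits.NavierStokesRegularity.NavierStokesRegularity.Theorems.TypeICertificateLadderTypeIConcentration
import Summits.NavierStokesRegularity.NavierStokesRegularity.Theorems.TypeICertificateLadderTargetTypeIZoomCompactness
import Summits.NavierStokesRegularity.NavierStokesRegularity.Theorems.SqueezeCycleExtremalElementExistsRegularity
import Summits.NavierStokesRegularity.NavierStokesRegularity.Theorems.Target.Negative.NormalForms
import Literature.Analysis.FluidPDE.TypeIAncientMild
import Literature.Analysis.FluidPDE.VorticityCalculus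
import Literature.Analysis.FluidPDE.VectorCalculusProofs

/-!
# Line `lamb-alignment-starvation` for crux `RungReynoldsOne` (stmt-NavierStokesRegularity-2882)
# — crux-plan skeleton, round 1 (merged Lamb line: `lamb-alignment-starvation` ⊇
#   `unit-reynolds-enstrophy-lyapunov`, `constant-speed-exclusion` folded in, per triage r1-1/2/3)

planner-cruxplan-stmt-NavierStokesRegularity-2882-lamb-alignment-starv-0, 2026-08-16.
Idea card `Cruxes/RungReynoldsOne/Ideas/lamb-alignment-starvation.md` (ideator 1); triage r1-1
pass, r1-2 pass, r1-3 pass (all three: SAME lever as `unit-reynolds-enstrophy-lyapunov`; sharpen =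
drop `EnstrophyConcentration` and the localisation, pass the FULL Lamb defect to the Type-I zoom
limit by Fatou, kill the saturation variety POINTWISE, feed non-triviality from the route's own
`TypeIConcentration` (stmt-2881, PROVED in the tree)). All sharpenings adopted; see the line card
`Lines/lamb-alignment-starvation.md`.

THE LINE (viscosity normalised to `1`, `S = νT`; `ω = curl v`). At collapse Reynolds number ONE —
`√(S−s)‖v(s,x)‖ ≤ 1` on a final window — the scale-invariant enstrophy `E(s) = √(S−s)‖ω(s)‖₂²`
of a classical Leray–Hopf Schwartz-datum solution is NON-INCREASING, with the EXACT defect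
  `−E'(s) = ½√(S−s)·[ ‖v×ω − 2 curl ω‖₂² + ‖v·ω‖₂² + ∫(1/(S−s) − |v|²)|ω|² ]`,
three non-negative terms (vorticity equation `∂ₛω = curl(v×ω) + Δω`, `⟨ω, curl F⟩ = ⟨curl ω, F⟩`,
`‖∇ω‖₂ = ‖curl ω‖₂`, Lagrange `|v×ω|² + (v·ω)² = |v|²|ω|²`). This is the `q = 2` budget of the
Disproof's §(c) at its tie `C = 1` (`enstrophy_budget_saturated`): the size-only inequality proves
nothing there, but the IDENTITY hands us a finite dimensionless space–time integral
  `∫_{s₁}^{S} √(S−s) ‖v×ω − 2 curl ω‖₂² ds ≤ 2 E(s₁) < ∞`                                    (S1)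
— the flow must become LAMB-ALIGNED (`curl ω ∥ v×ω`, coefficient exactly `2`) in scale-invariant
mean. Zoom parabolically at the concentration point `x₀` of `TypeIConcentration` along `s_k ↑ S`
with `λ_k² = S − s_k` (S2a: the zoomed fields are classical on `(A_k, 1)`, Oseen-mild between all
pairs of times — THIS is where the Leray–Hopf class enters, `typeIZoom_oseen_pairs` — obey
`√(1−τ)‖w_k‖ ≤ 1`, carry slice enstrophy `≤ E₀/√(1−τ)` (scale invariance of `E`), have Lamb
defect `→ 0` on every window (tails of (S1)), and keep `∫_{B(0,ρ√(1−τ))}|w_k|³ ≥ γ`). The tree's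
`typeIZoom_compactness` (KNSS Lemma 6.1) extracts a Type-I ancient mild limit `W`
(`IsTypeIAncientMild 1 W`, Oseen gauge); the enstrophy bound + defect `→ 0` pass the alignment to
the limit by integration by parts against tests and dominated convergence (no `C²_loc`
compactness, no Morrey bound needed), and locally uniform convergence passes the `L³` floor (S2b):
  `W × curl W = 2 curl curl W` pointwise on `(−∞,0) × ℝ³`,  `∫_{B(0,ρ√(1−t))} |W(t)|³ ≥ γ > 0`.
But Lamb saturation is SELF-ANNIHILATING (pointwise, PROVED below, `curl_eq_zero_of_lamb_saturation`):
`div(W × curl W) = |curl W|² − W·curl curl W` and `W ⊥ W × curl W` give `curl W ≡ 0`; a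
divergence-free irrotational bounded slice is harmonic hence constant (tree:
`HarmonicOnNhd.apply_eq_apply_of_abs_le`), and the Oseen gauge kills slice-constant elements
(tree: `IsTypeIAncientMild.eq_zero_of_slice_const` — the parasitic drifts of the Disproof's §(a)
die exactly here) (S3). So `W ≡ 0`, contradicting the `L³` floor at `t = −1`. Hence the
rate-one solution extends: `RungReynoldsOne`.

* `stub_lambDefectBudget` (S1, L): the frame — exact `C = 1` enstrophy–Lamb-defect identity for
  classical Leray–Hopf Schwartz-datum solutions, integrated up to `S`.
* `stub_zoomSequence` (S2a, M–L): parabolic zoom at the concentration point, bookkeeping over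
  `stPull`/`stRescale`/`oseen_smul_stPull`/`typeIZoom_oseen_pairs` and change of variables.
* `stub_saturatedAncientLimit` (S2b, L, HARDEST): `typeIZoom_compactness` + identification of the
  zero-defect limit (weak form of the alignment, IBP onto tests, dominated convergence) + `L³` floor.
* `stub_lambRigidity` (S3, M): a Lamb-saturated (`κ ≠ 0`) Type-I ancient mild field vanishes
  (pointwise non-saturation, proved here, + harmonic Liouville + Oseen gauge).
* `curl_eq_zero_of_lamb_saturation` (PROVED, the lever): `V × curl V = κ curl curl V`, `κ ≠ 0`,
  `V ∈ C³` ⇒ `curl V ≡ 0`.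
* `zoomLimit_typeIAncientMild` (PROVED): step (1) of S2b — the tree's `typeIZoom_compactness` +
  `isTypeIAncientMild_of_continuous_oseenMild` applied to a sequence of exactly S2a's shape
  (certifies that the S2a ↔ S2b interface matches the tree's compactness theorem).
* `rate_unit_viscosity` (PROVED): `ν ↦ 1` keeping the rate constant — a verbatim copy of the
  tree's `typeIZoom_unit_viscosity` (`Theorems/TypeICertificateLadderTargetTypeIZoomPhysical.lean`,
  landed 2026-08-16T05:19Z, not yet in the farm snapshot at check time; the lead may swap it).
* `RungReynoldsOne_of` — kernel-checked composition S1 → S2a → S2b → S3 → crux, through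
  `rate_unit_viscosity` and the tree's `typeIConcentration_proof` (stmt-2881, `C = 1`).

All stubs are stated over TREE VOCABULARY ONLY (`IsClassicalNSSolutionOn`, `IsLerayHopfOn`,
`HasRapidSpatialDecay`, `curl`, `cross`, `heatExtension`, `oseenDuhamel`, `IsTypeIAncientMild`,
Bochner/Lebesgue integrals), fully inlined, so each can be landed verbatim under
`Summits/…/Theorems/` with `--supports stmt-NavierStokesRegularity-2882`.
Disproof honoured: `rungReynoldsOne_false_without_LerayHopf` / `rung_false_with_weak_for_LerayHopf`
— the energy class is consumed in S2a (Oseen representation between pairs of times of the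
PHYSICAL solution, `typeIZoom_oseen_pairs`, false for the drifts `g(t)e₀`) and in the composition
through `typeIConcentration_proof`; `rungReynoldsOne_false_without_classical` — every identity is
pointwise on classical fields; `enstrophy_budget_saturated` — S1 is precisely the deficit the
`q = 2` tie demands. No stub is an instance of `Theorems/RungReynoldsOne/Negative/{BudgetCeiling,
WithoutLerayHopfFalse}` (real arithmetic / LH-free rung).
-/

noncomputable section

namespace Summit.NavierStokesRegularity.NavierStokesRegularity.Cruxes.RungReynoldsOne.LambAlignmentStarvation

open MeasureTheory Set Filter Topology Function Metric
open scoped RealInnerProductSpace ENNReal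
open Literature.Analysis.FluidPDE
open Summit.NavierStokesRegularity.NavierStokesRegularity.Theses.TypeICertificateLadder
open Summit.NavierStokesRegularity.NavierStokesRegularity.Theorems

set_option linter.dupNamespace false

/-! ## The lever, proved: Lamb saturation is self-annihilating (pointwise non-saturation) -/

/-- `⟪a, a × b⟫ = 0` (triple product with a repeated entry). [folklore] -/
theorem inner_self_cross_left (a b : EuclideanSpace ℝ (Fin 3)) : ⟪a, cross a b⟫ = 0 := by
  simp only [cross, PiLp.inner_apply, RCLike.inner_apply, conj_trivial, Fin.sum_univ_three,
    cross_apply, Matrix.cons_val_zero, Matrix.cons_val_one, Matrix.cons_val_two,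
    Matrix.head_cons, Matrix.tail_cons]
  ring

/-- **Pointwise non-saturation of the Lamb pairing** (the lever of the line; triage r1-3's
`NonSaturation.lean`, re-proved here). If a `C³` field `V` on `ℝ³` satisfies the Lamb-saturation
equation `V × curl V = κ • curl (curl V)` at every point, with `κ ≠ 0`, then `curl V ≡ 0`:
`div (V × curl V) = |curl V|² − ⟪V, curl curl V⟫` (`divergence_cross_holds`), the left side is
`div (curl (κ • curl V)) = 0` (`divergence_curl_eq_zero_holds`), and
`⟪V, curl curl V⟫ = κ⁻¹⟪V, V × curl V⟫ = 0`. The hypothesis `κ ≠ 0` is necessary (Beltrami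
fields `(cos z, sin z, 0)`: `V × curl V = 0`, `curl V = −V ≠ 0`); the zero-defect Type-I zoom
limit at `C = 1` meets it with `κ = 2`. [folklore vector calculus; Lamb 1932 §165 (Lamb vector)] -/
theorem curl_eq_zero_of_lamb_saturation
    {V : EuclideanSpace ℝ (Fin 3) → EuclideanSpace ℝ (Fin 3)} {κ : ℝ}
    (hV : ContDiff ℝ 3 V) (hκ : κ ≠ 0)
    (hsat : ∀ x, cross (V x) (curl V x) = κ • curl (curl V) x) :
    ∀ x, curl V x = 0 := by
  have hV3 : ContDiff ℝ ((2 : ℕ∞) + 1 : ℕ∞) V := by exact_mod_cast hV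
  have hcurl2 : ContDiff ℝ (2 : ℕ∞) (curl V) := contDiff_curl hV3
  have hVd : Differentiable ℝ V := hV.differentiable (by norm_num)
  have hcd : Differentiable ℝ (curl V) := hcurl2.differentiable (by norm_num)
  intro x
  -- `div (V × curl V) = ⟪curl V, curl V⟫ - ⟪V, curl (curl V)⟫`
  have h1 := divergence_cross_holds V (curl V) x (hVd x) (hcd x)
  -- `V × curl V = curl (κ • curl V)` as fields, so its divergence vanishes
  have hfun : (fun y => cross (V y) (curl V y)) = curl (fun y => κ • curl V y) := by
    funext y
    rw [hsat y, curl_const_smul (hcd y) κ]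
  have hdiv0 : VectorCalculus.divergence (fun y => cross (V y) (curl V y)) x = 0 := by
    rw [hfun]
    exact divergence_curl_eq_zero_holds (fun y => κ • curl V y) (hcurl2.const_smul κ) x
  -- `⟪V, curl curl V⟫ = κ⁻¹ ⟪V, V × curl V⟫ = 0`
  have h3 : ⟪V x, curl (curl V) x⟫ = 0 := by
    have e : curl (curl V) x = κ⁻¹ • cross (V x) (curl V x) := by
      rw [hsat x, smul_smul, inv_mul_cancel₀ hκ, one_smul]
    rw [e, inner_smul_right, inner_self_cross_left, mul_zero]
  have h4 : ⟪curl V x, curl V x⟫ = 0 := by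
    rw [hdiv0] at h1
    linarith
  exact inner_self_eq_zero.1 h4


/-! ## Proved infrastructure used by the composition / certifying the S2a–S2b interface -/

/-- **Viscosity normalisation keeping the rate constant** (verbatim copy of the tree theorem
`typeIZoom_unit_viscosity`, `Theorems/TypeICertificateLadderTargetTypeIZoomPhysical.lean` —
copied only because that module post-dates the farm snapshot at check time; Tao 2013,
footnote 3). Let `ν > 0`, `T > 0`, `(u, p)` classical on `ℝ³ × [0, T)` with viscosity `ν`,
Leray–Hopf from its rapidly decaying datum, with the eventual rate `√(T − t)‖u(t, x)‖ ≤ C√ν`, NOT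
extending classically past `T`. Then `v(s, x) = ν⁻¹ u(s/ν, x)`, `π(s, x) = ν⁻² p(s/ν, x)` is
classical on `ℝ³ × [0, νT)` with viscosity `1`, Leray–Hopf from its rapidly decaying datum,
satisfies `√(νT − s)‖v(s, x)‖ ≤ C` eventually, and does not extend classically past `νT`.
[cite: Tao2011, footnote 3; Leray1934 §20] -/
theorem rate_unit_viscosity :
    ∀ (C ν T : ℝ) (u : ℝ → EuclideanSpace ℝ (Fin 3) → EuclideanSpace ℝ (Fin 3))
      (p : ℝ → EuclideanSpace ℝ (Fin 3) → ℝ), 0 < ν → 0 < T →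
      Literature.Analysis.FluidPDE.IsClassicalNSSolutionOn (Set.Ico 0 T) ν 0 u p →
      Literature.Analysis.FluidPDE.IsLerayHopfOn T ν 0 (u 0) u →
      Literature.Analysis.FluidPDE.HasRapidSpatialDecay (u 0) →
      (∀ᶠ t in nhdsWithin T (Set.Iio T), ∀ x, Real.sqrt (T - t) * ‖u t x‖ ≤ C * Real.sqrt ν) →
      ¬ Literature.Analysis.FluidPDE.HasSmoothExtensionPast ν 0 u T →
      ∃ (v : ℝ → EuclideanSpace ℝ (Fin 3) → EuclideanSpace ℝ (Fin 3))
        (π : ℝ → EuclideanSpace ℝ (Fin 3) → ℝ),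
        Literature.Analysis.FluidPDE.IsClassicalNSSolutionOn (Set.Ico 0 (ν * T)) 1 0 v π ∧
        Literature.Analysis.FluidPDE.IsLerayHopfOn (ν * T) 1 0 (v 0) v ∧
        Literature.Analysis.FluidPDE.HasRapidSpatialDecay (v 0) ∧
        (∀ᶠ s in nhdsWithin (ν * T) (Set.Iio (ν * T)), ∀ x,
          Real.sqrt (ν * T - s) * ‖v s x‖ ≤ C) ∧
        ¬ Literature.Analysis.FluidPDE.HasSmoothExtensionPast 1 0 v (ν * T) := by
  -- verbatim from `typeIZoom_unit_viscosity` (pattern of `Cruxes/Target/Disproof.lean` §6)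
  intro C ν T u p hν hT hcl hLH hdec hrate hext
  have hν0 : ν ≠ 0 := hν.ne'
  have hνi : 0 < ν⁻¹ := inv_pos.2 hν
  have hνT : 0 < ν * T := mul_pos hν hT
  set v : ℝ → EuclideanSpace ℝ (Fin 3) → EuclideanSpace ℝ (Fin 3) := timeRescale ν⁻¹ ν⁻¹ u
    with hv
  set π : ℝ → EuclideanSpace ℝ (Fin 3) → ℝ := timeRescale ν⁻¹ (ν⁻¹ ^ 2) p with hπ
  have hmaps : MapsTo (fun s => ν⁻¹ * s) (Ico 0 (ν * T)) (Ico 0 T) := by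
    intro s hs
    refine ⟨mul_nonneg hνi.le hs.1, ?_⟩
    calc ν⁻¹ * s < ν⁻¹ * (ν * T) := mul_lt_mul_of_pos_left hs.2 hνi
      _ = T := by rw [← mul_assoc, inv_mul_cancel₀ hν0, one_mul]
  -- (1) classical at viscosity 1 on `[0, νT)`
  have hclv : IsClassicalNSSolutionOn (Ico 0 (ν * T)) 1 0 v π := by
    have h := hcl.viscosityRescale_set hν0 hmaps (uniqueDiffOn_Ico 0 (ν * T))
    rwa [timeRescale_zero_force] at h
  -- (2) Leray–Hopf
  have hv0 : ν⁻¹ • u 0 = v 0 := by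
    funext x
    simp [hv]
  have hLHv : IsLerayHopfOn (ν * T) 1 0 (v 0) v := by
    have h := hLH.viscosityRescale hνi
    have e1 : T / ν⁻¹ = ν * T := by rw [div_inv_eq_mul, mul_comm]
    rwa [e1, inv_mul_cancel₀ hν0, timeRescale_zero_force, hv0] at h
  -- (3) decay of the datum
  have hdecv : HasRapidSpatialDecay (v 0) := by
    rw [← hv0]
    exact SereginSverak2002_pressureOneSidedBound.hasRapidSpatialDecay_const_smul
      (hcl.contDiff_velocity ⟨le_rfl, hT⟩) hdec ν⁻¹
  -- (4) the rate, same constant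
  have hratev : ∀ᶠ s in 𝓝[<] (ν * T), ∀ x, Real.sqrt (ν * T - s) * ‖v s x‖ ≤ C := by
    have ht : Tendsto (fun s : ℝ => ν⁻¹ * s) (𝓝[<] (ν * T)) (𝓝[<] T) := by
      have := Target.Negative.tendsto_const_mul_nhdsLT (T := T) hνi
      rwa [inv_inv] at this
    filter_upwards [ht.eventually hrate, self_mem_nhdsWithin] with s hs hsT x
    have hsT' : s < ν * T := hsT
    have hpos : 0 < ν * T - s := sub_pos.2 hsT'
    have e : T - ν⁻¹ * s = ν⁻¹ * (ν * T - s) := by field_simp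
    have hsq : Real.sqrt (T - ν⁻¹ * s) = (Real.sqrt ν)⁻¹ * Real.sqrt (ν * T - s) := by
      rw [e, Real.sqrt_mul hνi.le, Real.sqrt_inv]
    have hb := hs x
    have hsν : 0 < Real.sqrt ν := Real.sqrt_pos.2 hν
    have hsνsq : Real.sqrt ν * Real.sqrt ν = ν := Real.mul_self_sqrt hν.le
    show Real.sqrt (ν * T - s) * ‖ν⁻¹ • u (ν⁻¹ * s) x‖ ≤ C
    rw [norm_smul, Real.norm_eq_abs, abs_of_pos hνi]
    rw [hsq] at hb
    have key : Real.sqrt (ν * T - s) * ‖u (ν⁻¹ * s) x‖ ≤ C * ν := by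
      have h2 := mul_le_mul_of_nonneg_left hb hsν.le
      rw [← mul_assoc, ← mul_assoc, mul_inv_cancel₀ hsν.ne', one_mul] at h2
      calc Real.sqrt (ν * T - s) * ‖u (ν⁻¹ * s) x‖ ≤ Real.sqrt ν * (C * Real.sqrt ν) := h2
        _ = C * (Real.sqrt ν * Real.sqrt ν) := by ring
        _ = C * ν := by rw [hsνsq]
    calc Real.sqrt (ν * T - s) * (ν⁻¹ * ‖u (ν⁻¹ * s) x‖)
        = ν⁻¹ * (Real.sqrt (ν * T - s) * ‖u (ν⁻¹ * s) x‖) := by ring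
      _ ≤ ν⁻¹ * (C * ν) := mul_le_mul_of_nonneg_left key hνi.le
      _ = C := by field_simp
  -- (5) no classical extension past `νT`: it would scale back to an extension of `u` past `T`
  have hextv : ¬ HasSmoothExtensionPast 1 0 v (ν * T) := by
    rintro ⟨T₁', hT₁', v', π', hcl', hagree'⟩
    apply hext
    have key := hcl'.stRescale hν one_pos (by rw [mul_one]) 0 0
    have hset : ((fun r => (0 : ℝ) + ν * r) ⁻¹' Ico 0 T₁') = Ico 0 (T₁' / ν) := by
      ext r
      simp only [mem_preimage, zero_add, mem_Ico]
      rw [lt_div_iff₀ hν, mul_comm r ν]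
      constructor
      · rintro ⟨h0, h1⟩
        exact ⟨by nlinarith [h0], h1⟩
      · rintro ⟨h0, h1⟩
        exact ⟨by positivity, h1⟩
    rw [hset, smul_stPull_zero, show ν * (1 : ℝ) / 1 = ν by simp] at key
    refine ⟨T₁' / ν, by rw [gt_iff_lt, lt_div_iff₀ hν, mul_comm]; exact hT₁', _, _, key,
      fun t ht => ?_⟩
    funext x
    have hνt : ν * t ∈ Ico 0 (ν * T) := ⟨mul_nonneg hν.le ht.1, mul_lt_mul_of_pos_left ht.2 hν⟩
    show ν • v' (0 + ν * t) (0 + (1 : ℝ) • x) = u t x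
    rw [zero_add, zero_add, one_smul, hagree' (ν * t) hνt]
    show ν • (ν⁻¹ • u (ν⁻¹ * (ν * t)) x) = u t x
    rw [← mul_assoc, inv_mul_cancel₀ hν0, one_mul, smul_smul, mul_inv_cancel₀ hν0, one_smul]
  exact ⟨v, π, hclv, hLHv, hdecv, hratev, hextv⟩

/-- **Step (1) of S2b, proved: the zoomed sequence has a Type-I ancient mild limit with
constant `1`.** For a sequence of EXACTLY the shape S2a delivers (classical on `(A k, 1)` at
viscosity `1`, `A k → −∞`, Oseen-mild between all pairs of times, rate `√(1−τ)‖w k τ y‖ ≤ 1`), the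
tree's compactness theorem `typeIZoom_compactness` (KNSS 2009 Lemma 6.1; `C = 1`, `B k = 1`,
since `√(−τ) ≤ √(1−τ)`) and `isTypeIAncientMild_of_continuous_oseenMild` (KNSS Prop. 4.1) give a
subsequence `φ` and a limit `W` with `IsTypeIAncientMild 1 W`, the sharper pointwise bound
`√(1−t)‖W t x‖ ≤ 1`, and `w (φ k) t → W t` locally uniformly for every `t < 0`. The prover of
S2b starts here and adds the `L³` floor and the Lamb saturation of THIS `W`.
[cite: KochNadirashviliSereginSverak2009, Lemma 6.1 and Prop. 4.1 (arXiv:0709.3599 pp. 8, 11)] -/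
theorem zoomLimit_typeIAncientMild (A : ℕ → ℝ)
    (w : ℕ → ℝ → EuclideanSpace ℝ (Fin 3) → EuclideanSpace ℝ (Fin 3))
    (q : ℕ → ℝ → EuclideanSpace ℝ (Fin 3) → ℝ)
    (hA : Filter.Tendsto A Filter.atTop Filter.atBot)
    (hcl : ∀ k, IsClassicalNSSolutionOn (Set.Ioo (A k) 1) 1 0 (w k) (q k))
    (hmild : ∀ k, ∀ s t : ℝ, A k < s → s < t → t < 1 → ∀ x,
        w k t x = Literature.Analysis.UnboundedOperators.heatExtension (w k s) (t - s) x -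
          oseenDuhamel 1 s (w k) (w k) t x)
    (hrate : ∀ k, ∀ τ ∈ Set.Ioo (A k) 1, ∀ y, Real.sqrt (1 - τ) * ‖w k τ y‖ ≤ 1) :
    ∃ (φ : ℕ → ℕ) (W : ℝ → EuclideanSpace ℝ (Fin 3) → EuclideanSpace ℝ (Fin 3)),
      StrictMono φ ∧ IsTypeIAncientMild 1 W ∧
      (∀ t < 0, ∀ x, Real.sqrt (1 - t) * ‖W t x‖ ≤ 1) ∧
      (∀ t < 0, TendstoLocallyUniformly (fun k => w (φ k) t) (W t) Filter.atTop) := by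
  have hrate' : ∀ k, ∀ τ ∈ Set.Ioo (A k) 0, ∀ x, Real.sqrt (-τ) * ‖w k τ x‖ ≤ 1 := by
    intro k τ hτ x
    have h := hrate k τ ⟨hτ.1, hτ.2.trans one_pos⟩ x
    have hle : Real.sqrt (-τ) ≤ Real.sqrt (1 - τ) := Real.sqrt_le_sqrt (by linarith)
    exact (mul_le_mul_of_nonneg_right hle (norm_nonneg _)).trans h
  obtain ⟨φ, W, hφ, hWc, hdiv, hbd, hmildW, hconv⟩ :=
    typeIZoom_compactness 1 A (fun _ => 1) w q one_pos hA (fun _ => one_pos) hcl hmild hrate'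
  have hdecay : HasTypeITimeDecay 1 W := by
    intro t ht x
    have h := hbd t ht x
    rw [le_div_iff₀ (Real.sqrt_pos.2 (neg_pos.2 ht)), mul_comm]
    exact h
  refine ⟨φ, W, hφ, isTypeIAncientMild_of_continuous_oseenMild hWc hdiv hmildW hdecay, ?_, hconv⟩
  -- the sharper bound `√(1 - t)‖W t x‖ ≤ 1` passes to the pointwise limit
  intro t ht x
  have hpt : Tendsto (fun k => w (φ k) t x) atTop (𝓝 (W t x)) :=
    (hconv t ht).tendstoLocallyUniformlyOn.tendsto_at (mem_univ x)
  refine le_of_tendsto (hpt.norm.const_mul (Real.sqrt (1 - t))) ?_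
  have hdom : ∀ᶠ j in atTop, A (φ j) < t :=
    (hA.comp hφ.tendsto_atTop).eventually (eventually_lt_atBot t)
  filter_upwards [hdom] with j hj
  exact hrate (φ j) t ⟨hj, ht.trans one_pos⟩ x

/-! ## The stubs (S1, S2a, S2b, S3) -/

/-- **S1 — the frame: exact `C = 1` enstrophy–Lamb-defect budget** (stub, size L).
For a classical solution `(v, π)` of unit-viscosity unforced Navier–Stokes on `ℝ³ × [0, S)`,
Leray–Hopf on `[0, S)` from its rapidly decaying datum, with collapse Reynolds number one on a
final window — `√(S − s)‖v(s, x)‖ ≤ 1` for `s ∈ (s₁, S)`, `0 < s₁ < S` — the scale-invariant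
enstrophy `E(s) := √(S − s) ∫ |curl v(s)|²` is finite and NON-INCREASING on `(s₁, S)`, with the
exact defect `−E' = ½√(S−s)[‖v×ω − 2curl ω‖₂² + ‖v·ω‖₂² + ∫((S−s)⁻¹ − |v|²)|ω|²]` (`ω = curl v`;
all three terms `≥ 0` by the rate). Conclusions kept minimal for the line: with `E₀ := E(s₁)`,
(i) `∫|curl v(s)|² ≤ E₀/√(S−s)` for `s ∈ (s₁,S)`; (ii) the weighted Lamb defect is integrable
up to the singular time, `∫∫_{(s₁,S)×ℝ³} √(S−s) |v×ω − 2 curl ω|² ≤ 2E₀`.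
Why true: `d/ds ∫|ω|² = 2⟨curl ω, v×ω⟩ − 2‖curl ω‖₂² = ½(‖v×ω‖₂² − ‖v×ω − 2curl ω‖₂²)` and
`‖v×ω‖² = ∫|v|²|ω|² − ‖v·ω‖² ≤ (S−s)⁻¹∫|ω|² − ‖v·ω‖²`; justification of the identities: on every
closed sub-slab `[0, S']` the solution is in Tao's `H^k` class (`tao2011_hasBoundedSobolevNormsOn_holds`),
so `ω(s) ∈ H^k` with decay, all integrations by parts hold, `s ↦ ∫|ω(s)|²` is `C¹`
(`IsSmoothSpaceTimeOn.enstrophy_balance`, cf. `Target.Negative.lintegral_frobeniusNormSq_le_exp_half_linfty`,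
`lintegral_frobeniusNormSq_fderiv_le_mul_exp`); integrate `−E'` over `(s₁, S')` and let `S' ↑ S`
(monotone convergence, `E ≥ 0`). Triage r1-1/2/3 re-derived the identity independently
(r1-1 Scratch ex.(1), kernel-checked as ring algebra). Honours `enstrophy_budget_saturated`
(Disproof §(c)): this IS the deficit of the `q = 2` tie.
[cite: folklore enstrophy identity in Lamb form; LemarieRieusset2016 Thm. 11.2; Tao2013 localisation (H^k class)] -/
theorem stub_lambDefectBudget :
    ∀ (S s₁ : ℝ) (v : ℝ → EuclideanSpace ℝ (Fin 3) → EuclideanSpace ℝ (Fin 3))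
      (π : ℝ → EuclideanSpace ℝ (Fin 3) → ℝ), 0 < s₁ → s₁ < S →
      IsClassicalNSSolutionOn (Set.Ico 0 S) 1 0 v π →
      IsLerayHopfOn S 1 0 (v 0) v →
      HasRapidSpatialDecay (v 0) →
      (∀ s ∈ Set.Ioo s₁ S, ∀ x, Real.sqrt (S - s) * ‖v s x‖ ≤ 1) →
      ∃ E₀ : ℝ, 0 ≤ E₀ ∧
        (∀ s ∈ Set.Ioo s₁ S,
          ∫⁻ x, ‖curl (v s) x‖ₑ ^ 2 ≤ ENNReal.ofReal (E₀ / Real.sqrt (S - s))) ∧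
        ∫⁻ z in Set.Ioo s₁ S ×ˢ (Set.univ : Set (EuclideanSpace ℝ (Fin 3))),
            ENNReal.ofReal (Real.sqrt (S - z.1) *
              ‖cross (v z.1 z.2) (curl (v z.1) z.2) - (2 : ℝ) • curl (curl (v z.1)) z.2‖ ^ 2)
          ≤ ENNReal.ofReal (2 * E₀) := by
  sorry

/-- **S2a — the parabolic zoom at the concentration point** (stub, size M–L; rescaling
bookkeeping). Data: `(v, π)` classical on `ℝ³ × [0,S)` (viscosity `1`), Leray–Hopf from its
rapidly decaying datum, and on a window `(s₁, S)`, `0 < s₁`: the rate `√(S−s)‖v‖ ≤ 1`, the slice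
enstrophy bound `∫|curl v(s)|² ≤ E₀/√(S−s)`, a FINITE weighted Lamb defect
`∫∫ √(S−s)|v×ω − 2curl ω|² < ∞`, and the `L³` floor `γ ≤ ∫_{B(x₀, ρ√(S−s))}|v(s)|³` (from
`TypeIConcentration`). Conclusion: a zoomed sequence in exactly the shape consumed by the tree's
`typeIZoom_compactness` (`B k = 1`), plus three extra clauses. Construction: `s_k := S − 4^{-k}(S − s₁)`,
`λ_k := √(S − s_k)`, `w k := λ_k • stPull λ_k² λ_k s_k x₀ v` (`w k τ y = λ_k v(s_k + λ_k²τ, x₀ + λ_k y)`),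
`q k := λ_k² • stPull … π`, `A k := −(s_k − s₁)/λ_k² → −∞`; then `τ ∈ (A k, 1) ⇔ s ∈ (s₁, S)` and
`S − s = λ_k²(1 − τ)`. Classical on `(A k, 1)`: `IsClassicalNSSolutionOn.stRescale` (`α = γ = λ_k`,
`β = λ_k²`, viscosity `λ_k·1/λ_k = 1`) restricted to the open sub-interval. Oseen pairs:
`typeIZoom_oseen_pairs` for `v` between physical times `0 < s₁ < s < t < S` (the Leray–Hopf
class is used HERE — honouring `rung_false_with_weak_for_LerayHopf`: the drifts are not
Oseen-mild) transported by `oseen_smul_stPull` / `heatExtension_smul_stPull` /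
`oseenDuhamel_smul_stPull`. Rate: `√(1−τ)‖w k τ y‖ = λ_k√(1−τ)‖v‖ = √(S−s)‖v‖ ≤ 1`. Enstrophy:
`curl (w k τ) y = λ_k² (curl v(s))(x₀+λ_k y)` (chain rule), so `∫|curl w k τ|² = λ_k ∫|curl v(s)|²
≤ E₀/√(1−τ)`. Defect: the unweighted zoomed density is `λ_k⁶ ×` the physical one, `dτ dy =
λ_k^{-5} ds dx`, and `λ_k ≤ √(S−s)` on windows `τ ≤ b < 0`, so the zoomed integral over
`(a,b) × ℝ³` is at most the physical WEIGHTED integral over `(s_k + λ_k²a, S) × ℝ³`, a tail of a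
finite integral over sets decreasing to `∅` — tends to `0` (continuity from above). `L³` floor:
`∫_{B(0,ρ√(1−τ))}|w k τ|³ = ∫_{B(x₀, ρλ_k√(1−τ))}|v(s)|³ = ∫_{B(x₀,ρ√(S−s))}|v(s)|³ ≥ γ`
(`L³` is scale invariant). Every step is a change of variables (`MeasureTheory.Measure.map` of
the affine dilation, `integral_comp_smul`/`lintegral` versions, `setIntegral_Ioo_comp_add_sq_mul`).
[cite: KochNadirashviliSereginSverak2009, §1 (1.2) and §6 (arXiv:0709.3599); Leray1934 §20 (similarity)] -/
theorem stub_zoomSequence :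
    ∀ (S s₁ ρ γ E₀ : ℝ) (x₀ : EuclideanSpace ℝ (Fin 3))
      (v : ℝ → EuclideanSpace ℝ (Fin 3) → EuclideanSpace ℝ (Fin 3))
      (π : ℝ → EuclideanSpace ℝ (Fin 3) → ℝ), 0 < s₁ → s₁ < S →
      IsClassicalNSSolutionOn (Set.Ico 0 S) 1 0 v π →
      IsLerayHopfOn S 1 0 (v 0) v →
      HasRapidSpatialDecay (v 0) →
      (∀ s ∈ Set.Ioo s₁ S, ∀ x, Real.sqrt (S - s) * ‖v s x‖ ≤ 1) →
      (∀ s ∈ Set.Ioo s₁ S,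
        ∫⁻ x, ‖curl (v s) x‖ₑ ^ 2 ≤ ENNReal.ofReal (E₀ / Real.sqrt (S - s))) →
      (∫⁻ z in Set.Ioo s₁ S ×ˢ (Set.univ : Set (EuclideanSpace ℝ (Fin 3))),
          ENNReal.ofReal (Real.sqrt (S - z.1) *
            ‖cross (v z.1 z.2) (curl (v z.1) z.2) - (2 : ℝ) • curl (curl (v z.1)) z.2‖ ^ 2) < ⊤) →
      (∀ s ∈ Set.Ioo s₁ S,
        γ ≤ ∫ x in Metric.ball x₀ (ρ * Real.sqrt (S - s)), ‖v s x‖ ^ 3) →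
      ∃ (A : ℕ → ℝ) (w : ℕ → ℝ → EuclideanSpace ℝ (Fin 3) → EuclideanSpace ℝ (Fin 3))
        (q : ℕ → ℝ → EuclideanSpace ℝ (Fin 3) → ℝ),
        Filter.Tendsto A Filter.atTop Filter.atBot ∧
        (∀ k, IsClassicalNSSolutionOn (Set.Ioo (A k) 1) 1 0 (w k) (q k)) ∧
        (∀ k, ∀ s t : ℝ, A k < s → s < t → t < 1 → ∀ x,
          w k t x = Literature.Analysis.UnboundedOperators.heatExtension (w k s) (t - s) x -
            oseenDuhamel 1 s (w k) (w k) t x) ∧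
        (∀ k, ∀ τ ∈ Set.Ioo (A k) 1, ∀ y, Real.sqrt (1 - τ) * ‖w k τ y‖ ≤ 1) ∧
        (∀ k, ∀ τ ∈ Set.Ioo (A k) 1,
          ∫⁻ y, ‖curl (w k τ) y‖ₑ ^ 2 ≤ ENNReal.ofReal (E₀ / Real.sqrt (1 - τ))) ∧
        (∀ a b : ℝ, a < b → b < 0 →
          Filter.Tendsto (fun k =>
            ∫⁻ z in Set.Ioo a b ×ˢ (Set.univ : Set (EuclideanSpace ℝ (Fin 3))),
              ENNReal.ofReal (‖cross (w k z.1 z.2) (curl (w k z.1) z.2) -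
                (2 : ℝ) • curl (curl (w k z.1)) z.2‖ ^ 2)) Filter.atTop (nhds 0)) ∧
        (∀ k, ∀ τ ∈ Set.Ioo (A k) 1,
          γ ≤ ∫ y in Metric.ball (0 : EuclideanSpace ℝ (Fin 3)) (ρ * Real.sqrt (1 - τ)),
            ‖w k τ y‖ ^ 3) := by
  sorry

/-- **S2b — the zero-defect Type-I ancient limit (HARDEST stub, size L).** A zoomed sequence as
produced by S2a — classical on `(A k, 1)` with `A k → −∞`, Oseen-mild between all pairs of times,
rate `√(1−τ)‖w k‖ ≤ 1`, slice enstrophy `≤ E₀/√(1−τ)`, unweighted Lamb defect `→ 0` on every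
window `(a, b) × ℝ³`, `a < b < 0`, and `L³` floor `γ` on the balls `B(0, ρ√(1−τ))` — has a limit
`W` which (1) is a Type-I ancient mild field in the Oseen gauge with constant `1`
(`IsTypeIAncientMild 1 W`), (2) is LAMB-SATURATED, `W × curl W = 2 • curl (curl W)` pointwise on
`(−∞, 0) × ℝ³`, and (3) keeps the `L³` floor, `γ ≤ ∫_{B(0,ρ√(1−t))} |W(t)|³` for every `t < 0`.
Why true: (1) `typeIZoom_compactness` (tree; KNSS Lemma 6.1: `C = 1`, `B k = 1`, rate
`√(−τ) ≤ √(1−τ)`) gives `φ`, `W` continuous on `(−∞,0) × ℝ³`, weakly divergence-free slices,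
`√(−t)‖W‖ ≤ 1` (= `HasTypeITimeDecay 1 W`), Oseen pairs, `w (φ k) t → W t` locally uniformly for
each `t < 0`; then `isTypeIAncientMild_of_continuous_oseenMild` (tree, KNSS Prop. 4.1). (3)
uniform convergence on the compact ball with the uniform bound `‖w‖ ≤ 1`. (2) For a test field
`φ ∈ C_c^∞((a,b) × ℝ³; ℝ³)`: `∫∫⟪2 curl curl w_k − w_k × curl w_k, φ⟫ → 0` by Cauchy–Schwarz
against the defect; `∫∫⟪curl curl w_k, φ⟫ = ∫∫⟪w_k, curl curl φ⟫ → ∫∫⟪W, curl curl φ⟫ =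
∫∫⟪curl curl W, φ⟫` (slice IBP `integral_inner_curl_eq_integral_inner_curl`, dominated
convergence with `‖w_k‖ ≤ 1`, smoothness of `W`); `∫∫⟪w_k × curl w_k, φ⟫ = ∫∫⟪curl w_k, φ × w_k⟫`,
where `‖curl w_k‖_{L²((a,b)×ℝ³)} ≤ √((b−a)E₀)` and `‖φ × (w_k − W)‖_{L²} → 0` (dominated
convergence slice-wise), while `∫∫⟪curl w_k, φ × W⟫ = ∫∫⟪w_k, curl(φ × W)⟫ → ∫∫⟪W, curl(φ × W)⟫ =
∫∫⟪W × curl W, φ⟫`; so `2 curl curl W − W × curl W` annihilates all tests and, being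
continuous, vanishes. No weak compactness, no `C²_loc` convergence, no Morrey bound is needed.
[cite: KochNadirashviliSereginSverak2009, Lemma 6.1 and Prop. 4.1 (arXiv:0709.3599 pp. 8, 11)] -/
theorem stub_saturatedAncientLimit :
    ∀ (ρ γ E₀ : ℝ) (A : ℕ → ℝ) (w : ℕ → ℝ → EuclideanSpace ℝ (Fin 3) → EuclideanSpace ℝ (Fin 3))
      (q : ℕ → ℝ → EuclideanSpace ℝ (Fin 3) → ℝ),
      Filter.Tendsto A Filter.atTop Filter.atBot →
      (∀ k, IsClassicalNSSolutionOn (Set.Ioo (A k) 1) 1 0 (w k) (q k)) →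
      (∀ k, ∀ s t : ℝ, A k < s → s < t → t < 1 → ∀ x,
        w k t x = Literature.Analysis.UnboundedOperators.heatExtension (w k s) (t - s) x -
          oseenDuhamel 1 s (w k) (w k) t x) →
      (∀ k, ∀ τ ∈ Set.Ioo (A k) 1, ∀ y, Real.sqrt (1 - τ) * ‖w k τ y‖ ≤ 1) →
      (∀ k, ∀ τ ∈ Set.Ioo (A k) 1,
        ∫⁻ y, ‖curl (w k τ) y‖ₑ ^ 2 ≤ ENNReal.ofReal (E₀ / Real.sqrt (1 - τ))) →
      (∀ a b : ℝ, a < b → b < 0 →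
        Filter.Tendsto (fun k =>
          ∫⁻ z in Set.Ioo a b ×ˢ (Set.univ : Set (EuclideanSpace ℝ (Fin 3))),
            ENNReal.ofReal (‖cross (w k z.1 z.2) (curl (w k z.1) z.2) -
              (2 : ℝ) • curl (curl (w k z.1)) z.2‖ ^ 2)) Filter.atTop (nhds 0)) →
      (∀ k, ∀ τ ∈ Set.Ioo (A k) 1,
        γ ≤ ∫ y in Metric.ball (0 : EuclideanSpace ℝ (Fin 3)) (ρ * Real.sqrt (1 - τ)),
          ‖w k τ y‖ ^ 3) →
      ∃ W : ℝ → EuclideanSpace ℝ (Fin 3) → EuclideanSpace ℝ (Fin 3),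
        IsTypeIAncientMild 1 W ∧
        (∀ t < 0, ∀ x, cross (W t x) (curl (W t) x) = (2 : ℝ) • curl (curl (W t)) x) ∧
        (∀ t < 0, γ ≤ ∫ x in Metric.ball (0 : EuclideanSpace ℝ (Fin 3)) (ρ * Real.sqrt (1 - t)),
          ‖W t x‖ ^ 3) := by
  sorry

/-- **S3 — Lamb rigidity in the Oseen gauge** (stub, size M). A Type-I ancient mild field `W`
(any constant `C`) which is Lamb-saturated with a NON-ZERO coefficient,
`W × curl W = κ • curl (curl W)` pointwise on `(−∞,0) × ℝ³`, vanishes identically.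
Why true: slices are `C^∞` (`IsTypeIAncientMild.contDiff_slice`), so
`curl_eq_zero_of_lamb_saturation` (proved above) gives `curl (W t) ≡ 0`; with `div (W t) = 0`
(`IsTypeIAncientMild.isDivFree`) every component of `W t` is harmonic (`Δ = ∇div − curl curl`)
and bounded by `C/√(−t)` (`IsTypeIAncientMild.norm_le`), hence constant by Liouville
(tree: `InnerProductSpace.HarmonicOnNhd.apply_eq_apply_of_abs_le`, BoundedAnnihilator.lean);
slice-constant elements of the Oseen gauge are zero (tree: `IsTypeIAncientMild.eq_zero_of_slice_const`,
KNSS Remark 6.1 — exactly where the parasitic drifts `g(t)e₀` of `Disproof.lean` §(a) are excluded).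
`κ ≠ 0` is necessary (Beltrami eigenfields are not excluded pointwise but are not Type-I ancient
mild either). [cite: KochNadirashviliSereginSverak2009, Lemma 3.1 and Remark 6.1 (arXiv:0709.3599 pp. 7, 11); GilbargTrudinger2001 Thm. 2.1] -/
theorem stub_lambRigidity :
    ∀ (C κ : ℝ) (W : ℝ → EuclideanSpace ℝ (Fin 3) → EuclideanSpace ℝ (Fin 3)),
      IsTypeIAncientMild C W → κ ≠ 0 →
      (∀ t < 0, ∀ x, cross (W t x) (curl (W t) x) = κ • curl (curl (W t)) x) →
      ∀ t < 0, ∀ x, W t x = 0 := by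
  sorry

/-! ## The composition: S1 → S2a → S2b → S3 → `RungReynoldsOne` (kernel-checked modulo the four stubs, used BY NAME) -/

/-- **`RungReynoldsOne` from the four stubs (each used by name; no other hypothesis).** By contradiction: a rate-one classical
Leray–Hopf Schwartz-datum solution that does not extend is normalised to viscosity `1`
(`rate_unit_viscosity` = the tree's `typeIZoom_unit_viscosity`, rate constant `1` kept); `typeIConcentration_proof` (stmt-2881,
PROVED) at `C = ν = 1` gives the `L³` floor at some `x₀` on a final window, which we intersect
with the rate window to get `(s₁, S)`, `0 < s₁`; S1 gives the enstrophy bound and the finite Lamb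
defect; S2a the zoomed sequence; S2b the Lamb-saturated Type-I ancient mild limit `W` with the
`L³` floor; S3 (`κ = 2 ≠ 0`) forces `W ≡ 0`, so the floor `γ ≤ ∫_{B(0,ρ√2)} |W(−1)|³ = 0`
contradicts `γ > 0`. -/
theorem RungReynoldsOne_of : RungReynoldsOne := by
  intro ν T hν hT u p hcl hLH hdec hrate
  by_contra hext
  -- normalise the viscosity to `1` (rate constant `C = 1` is kept)
  have hrate1 : ∀ᶠ t in 𝓝[<] T, ∀ x, Real.sqrt (T - t) * ‖u t x‖ ≤ 1 * Real.sqrt ν := by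
    simpa only [one_mul] using hrate
  obtain ⟨v, π, hclv, hLHv, hdecv, hratev, hextv⟩ :=
    rate_unit_viscosity 1 ν T u p hν hT hcl hLH hdec hrate1 hext
  have hS0 : 0 < ν * T := mul_pos hν hT
  -- the `L³` floor at a point (crux `TypeIConcentration`, stmt-2881, proved in the tree), `C = ν = 1`
  obtain ⟨ρ, _hρ, γ, hγ, hconc⟩ := typeIConcentration_proof 1 one_pos
  have hratev' : ∀ᶠ s in 𝓝[<] (ν * T), ∀ x,
      Real.sqrt (ν * T - s) * ‖v s x‖ ≤ 1 * Real.sqrt 1 := by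
    simpa only [Real.sqrt_one, mul_one] using hratev
  obtain ⟨x₀, hx₀⟩ := hconc 1 (ν * T) one_pos hS0 v π hclv hLHv hdecv hratev' hextv
  -- a common final window `(s₁, νT)` with `0 < s₁`
  obtain ⟨l, hlS, hl⟩ := mem_nhdsLT_iff_exists_Ioo_subset.1 (hratev.and hx₀)
  set s₁ : ℝ := max l (ν * T / 2) with hs₁
  have hs₁0 : 0 < s₁ := lt_max_of_lt_right (by positivity)
  have hs₁S : s₁ < ν * T := max_lt hlS (by linarith)
  have hwin : ∀ s ∈ Ioo s₁ (ν * T), (∀ x, Real.sqrt (ν * T - s) * ‖v s x‖ ≤ 1) ∧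
      γ * 1 ^ 3 ≤ ∫ x in Metric.ball x₀ (ρ * Real.sqrt (1 * (ν * T - s))), ‖v s x‖ ^ 3 :=
    fun s hs => hl ⟨(le_max_left _ _).trans_lt hs.1, hs.2⟩
  have hrateW : ∀ s ∈ Ioo s₁ (ν * T), ∀ x, Real.sqrt (ν * T - s) * ‖v s x‖ ≤ 1 :=
    fun s hs => (hwin s hs).1
  have hconcW : ∀ s ∈ Ioo s₁ (ν * T),
      γ ≤ ∫ x in Metric.ball x₀ (ρ * Real.sqrt (ν * T - s)), ‖v s x‖ ^ 3 := by
    intro s hs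
    have h := (hwin s hs).2
    simpa only [one_pow, mul_one, one_mul] using h
  -- S1: enstrophy bound and finite Lamb defect
  obtain ⟨E₀, _hE₀, hens, hdef⟩ :=
    stub_lambDefectBudget (ν * T) s₁ v π hs₁0 hs₁S hclv hLHv hdecv hrateW
  -- S2a: the zoomed sequence at `x₀`
  obtain ⟨A, w, q, hA, hclw, hmildw, hratew, hensw, hdefw, hconcw⟩ :=
    stub_zoomSequence (ν * T) s₁ ρ γ E₀ x₀ v π hs₁0 hs₁S hclv hLHv hdecv hrateW hens
      (lt_of_le_of_lt hdef ENNReal.ofReal_lt_top) hconcW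
  -- S2b: the Lamb-saturated Type-I ancient mild limit
  obtain ⟨W, hW, hsat, hfloor⟩ :=
    stub_saturatedAncientLimit ρ γ E₀ A w q hA hclw hmildw hratew hensw hdefw hconcw
  -- S3: rigidity, `κ = 2`
  have hzero : ∀ t < 0, ∀ x, W t x = 0 := stub_lambRigidity 1 2 W hW two_ne_zero hsat
  -- contradiction with the `L³` floor at `t = -1`
  have key := hfloor (-1) (by norm_num)
  have hint : ∫ x in Metric.ball (0 : EuclideanSpace ℝ (Fin 3)) (ρ * Real.sqrt (1 - (-1))),
      ‖W (-1) x‖ ^ 3 = 0 := by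
    simp [hzero (-1) (by norm_num)]
  linarith

end Summit.NavierStokesRegularity.NavierStokesRegularity.Cruxes.RungReynoldsOne.LambAlignmentStarvation

end
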